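import Literature.Probability.LatticeModels.TwoPointLogConvex
import Literature.Probability.LatticeModels.CriticalTwoPointBounds
import Literature.Probability.LatticeModels.HighDimPointwiseTriviality
import HarnessLib

/-!
# Axis ratio regularity of the critical two-point function on `ℤ³`:
# `⟨σ₀σ_{(k+1)eᵢ}⟩_{β_c} / ⟨σ₀σ_{k eᵢ}⟩_{β_c} ↑ 1`

Topic `Literature/Probability/LatticeModels`; family `crit-ising`. THEOREMS ONLY (no definition, no
named fact, no sorry). Written by the standing crux disprover of `MoebiusLimitExists`
(item stmt-CriticalPhenomena-1344) to settle a point that several routes and refuter files treat as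
open ("ratio regularity of `⟨σ₀σ_x⟩_{β_c}` on `ℤ³`"): ALONG A LATTICE AXIS it is a theorem.

Mechanism (Aizenman–Duminil-Copin 2021, Prop. 5.3/8.6 and the Cauchy–Schwarz step of Prop. 5.9,
both in the tree: `axisForm_sq_le`, infinite-volume log-convexity at every `β` with `m*(β) = 0`,
hence at `β_c` for `d ≥ 3` by `spontaneousMagnetization_criticalBeta_eq_zero_holds`):
`g(k) = ⟨σ₀σ_{k eᵢ}⟩_{β_c}` is LOG-CONVEX in `k ≥ 1`, so the ratios `r_k = g(k+1)/g(k)` are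
NONDECREASING (`criticalTwoPoint_axis_ratio_mono`); they are `≤ 1` because `g ≤ 1` forbids
exponential growth (`criticalTwoPoint_axis_ratio_le_one`, whence `g` is nonincreasing along the axis
without Messager–Miracle-Solé, `criticalTwoPoint_axis_succ_le`); a nondecreasing bounded sequence
converges, and its limit is `1` because a limit `L < 1` would force `g(k) ≤ g(1) Lᵏ`, against the
Simon–Lieb lower bound `g(k) ≥ c k⁻²` (`criticalTwoPoint_bounds_holds`):
**`criticalTwoPoint_axis_ratio_tendsto_one`**. What remains OPEN is the quantitative rate
`1 − r_k = O(1/k)` (equivalently two-point DOUBLING `g(k) ≤ K g(2k)`), and ratio regularity in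
non-axis directions uniformly (the cofinite statement `⟨σ₀σ_{x+u}⟩/⟨σ₀σ_x⟩ → 1`).

References: M. Aizenman, H. Duminil-Copin, Ann. of Math. 194 (2021), Prop. 5.3, §5.5 proof of
Prop. 5.9, Appendix A.3 Prop. 8.6 [AizenmanDuminilCopinAnnals2021]; B. Simon, CMP 77 (1980) Thm. 1
[Simon1980].
-/

noncomputable section

open Filter Topology Set

namespace Literature.Probability.LatticeModels

/-- `⟨σ₀σ_{n eᵢ}⟩_{β_c} > 0` on `ℤ³` (Simon–Lieb lower bound off the origin, `⟨σ₀²⟩ = 1` at it).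
[cite: Simon1980, Thm. 1] -/
private theorem criticalTwoPoint_axisDir_pos (i : Fin 3) (n : ℕ) :
    0 < criticalTwoPoint 3 (Pi.single i (n : ℤ)) := by
  by_cases hx : (Pi.single i (n : ℤ) : Site 3) = 0
  · rw [hx, criticalTwoPoint_zero']; exact one_pos
  · obtain ⟨c, C, hc, hb⟩ := criticalTwoPoint_bounds_holds (d := 3) le_rfl
    exact lt_of_lt_of_le (mul_pos hc (Real.rpow_pos_of_pos (norm_pos_iff.2 hx) _)) (hb _ hx).1

/-- **Log-convexity of the critical axis two-point function on `ℤ³`**: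
`⟨σ₀σ_{n eᵢ}⟩² ≤ ⟨σ₀σ_{(n−1)eᵢ}⟩ ⟨σ₀σ_{(n+1)eᵢ}⟩` for `n ≥ 1` (the one-point axis form of the tree's
`axisForm_sq_le` at `β = β_c`, `m*(β_c) = 0`). [cite: AizenmanDuminilCopinAnnals2021, arXiv:1912.07973 Prop. 5.3 (5.17) and §5.5 proof of Prop. 5.9 (p. 19)] -/
theorem criticalTwoPoint_axis_sq_le (i : Fin 3) {n : ℕ} (hn : 1 ≤ n) :
    criticalTwoPoint 3 (Pi.single i (n : ℤ)) ^ 2 ≤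
      criticalTwoPoint 3 (Pi.single i ((n - 1 : ℕ) : ℤ)) * criticalTwoPoint 3 (Pi.single i ((n + 1 : ℕ) : ℤ)) := by
  have hβ : 0 ≤ criticalBeta (2 + 1) := criticalBeta_nonneg _
  have hm : spontaneousMagnetization (2 + 1) (criticalBeta (2 + 1)) = 0 :=
    spontaneousMagnetization_criticalBeta_eq_zero_holds (d := 2 + 1) (by norm_num)
  have key := axisForm_sq_le (d' := 2) hβ hm i (fun _ : Fin 1 => (1 : ℝ)) (fun _ => 0)
    (fun _ => rfl) hn
  have hform : ∀ m : ℕ, axisForm (criticalBeta (2 + 1)) i (fun _ : Fin 1 => (1 : ℝ)) (fun _ => 0) m =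
      criticalTwoPoint 3 (Pi.single i (m : ℤ)) := by
    intro m
    simp [axisForm, criticalTwoPoint]
  simpa only [hform] using key

/-- **The axis ratios are nondecreasing**: `k ↦ ⟨σ₀σ_{(k+2)eᵢ}⟩/⟨σ₀σ_{(k+1)eᵢ}⟩` is monotone
(log-convexity and positivity). [cite: AizenmanDuminilCopinAnnals2021, arXiv:1912.07973 §5.5 proof of Prop. 5.9 (p. 19)] -/
theorem criticalTwoPoint_axis_ratio_mono (i : Fin 3) :
    Monotone fun k : ℕ => criticalTwoPoint 3 (Pi.single i ((k + 2 : ℕ) : ℤ)) /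
      criticalTwoPoint 3 (Pi.single i ((k + 1 : ℕ) : ℤ)) := by
  refine monotone_nat_of_le_succ fun k => ?_
  have h1 := criticalTwoPoint_axisDir_pos i (k + 1)
  have h2 := criticalTwoPoint_axisDir_pos i (k + 2)
  have key := criticalTwoPoint_axis_sq_le i (n := k + 2) (by omega)
  rw [show k + 2 - 1 = k + 1 by omega] at key
  rw [show k + 1 + 1 = k + 2 by omega, show k + 1 + 2 = k + 2 + 1 by omega, div_le_div_iff₀ h1 h2]
  nlinarith [key]

/-- **The axis ratios are at most `1`**: `⟨σ₀σ_{(k+2)eᵢ}⟩ ≤ ⟨σ₀σ_{(k+1)eᵢ}⟩`-type monotonicity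
from log-convexity and `⟨σσ⟩ ≤ 1` alone (a ratio `> 1` would persist and force exponential growth).
[cite: AizenmanDuminilCopinAnnals2021, arXiv:1912.07973 §5.5 proof of Prop. 5.9 (p. 19)] -/
theorem criticalTwoPoint_axis_ratio_le_one (i : Fin 3) (k : ℕ) :
    criticalTwoPoint 3 (Pi.single i ((k + 2 : ℕ) : ℤ)) /
      criticalTwoPoint 3 (Pi.single i ((k + 1 : ℕ) : ℤ)) ≤ 1 := by
  set G : ℕ → ℝ := fun n => criticalTwoPoint 3 (Pi.single i (n : ℤ)) with hG
  set r : ℕ → ℝ := fun k => G (k + 2) / G (k + 1) with hr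
  have hGpos : ∀ n, 0 < G n := fun n => criticalTwoPoint_axisDir_pos i n
  have hmono : Monotone r := criticalTwoPoint_axis_ratio_mono i
  have hstep : ∀ j, G (j + 2) = r j * G (j + 1) := by
    intro j
    rw [hr]
    dsimp only
    field_simp [(hGpos (j + 1)).ne']
  show r k ≤ 1
  by_contra hlt
  push Not at hlt
  have hrk0 : 0 < r k := by linarith
  -- exponential growth from `k + 1` on
  have hgrow : ∀ m : ℕ, r k ^ m * G (k + 1) ≤ G (k + m + 1) := by
    intro m
    induction m with
    | zero => simp
    | succ m ih =>
      have hkm : r k ≤ r (k + m) := hmono (Nat.le_add_right k m)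
      rw [show k + (m + 1) + 1 = k + m + 2 by omega, hstep (k + m), pow_succ]
      calc r k ^ m * r k * G (k + 1) = r k * (r k ^ m * G (k + 1)) := by ring
        _ ≤ r (k + m) * G (k + m + 1) :=
            mul_le_mul hkm ih (mul_nonneg (pow_nonneg hrk0.le m) (hGpos _).le)
              (le_trans hrk0.le hkm)
  have hle1 : ∀ m : ℕ, r k ^ m * G (k + 1) ≤ 1 := fun m =>
    (hgrow m).trans (criticalTwoPoint_le_one' _)
  have htop : Tendsto (fun m : ℕ => r k ^ m * G (k + 1)) atTop atTop :=
    (tendsto_pow_atTop_atTop_of_one_lt hlt).atTop_mul_const (hGpos (k + 1))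
  obtain ⟨m, hm⟩ := (htop.eventually_gt_atTop 1).exists
  exact absurd (hle1 m) (not_le.2 hm)

/-- The critical two-point function is nonincreasing along every lattice axis (beyond the first
step), by log-convexity alone. [cite: AizenmanDuminilCopinAnnals2021, arXiv:1912.07973 §5.5 proof of Prop. 5.9 (p. 19)] -/
theorem criticalTwoPoint_axis_succ_le (i : Fin 3) (k : ℕ) :
    criticalTwoPoint 3 (Pi.single i ((k + 2 : ℕ) : ℤ)) ≤ criticalTwoPoint 3 (Pi.single i ((k + 1 : ℕ) : ℤ)) := by
  have h := criticalTwoPoint_axis_ratio_le_one i k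
  rwa [div_le_one (criticalTwoPoint_axisDir_pos i (k + 1))] at h

/-- **AXIS RATIO REGULARITY AT CRITICALITY ON `ℤ³`**:
`⟨σ₀σ_{(k+2)eᵢ}⟩_{β_c} / ⟨σ₀σ_{(k+1)eᵢ}⟩_{β_c} → 1` as `k → ∞` — the ratios are nondecreasing and
bounded by `1`, so they converge, and a limit `L < 1` would give `⟨σ₀σ_{(k+1)eᵢ}⟩ ≤ Lᵏ`, against the
Simon–Lieb bound `≥ c k⁻²`. (Only the RATE is open: `1 − r_k = O(1/k)` is two-point doubling.)
[cite: AizenmanDuminilCopinAnnals2021, arXiv:1912.07973 Prop. 5.3 (5.17) and §5.5 proof of Prop. 5.9 (p. 19)] -/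
theorem criticalTwoPoint_axis_ratio_tendsto_one (i : Fin 3) :
    Tendsto (fun k : ℕ => criticalTwoPoint 3 (Pi.single i ((k + 2 : ℕ) : ℤ)) /
      criticalTwoPoint 3 (Pi.single i ((k + 1 : ℕ) : ℤ))) atTop (𝓝 1) := by
  set G : ℕ → ℝ := fun n => criticalTwoPoint 3 (Pi.single i (n : ℤ)) with hG
  set r : ℕ → ℝ := fun k => G (k + 2) / G (k + 1) with hr
  have hGpos : ∀ n, 0 < G n := fun n => criticalTwoPoint_axisDir_pos i n
  have hmono : Monotone r := criticalTwoPoint_axis_ratio_mono i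
  have hle : ∀ k, r k ≤ 1 := criticalTwoPoint_axis_ratio_le_one i
  have hstep : ∀ j, G (j + 2) = r j * G (j + 1) := by
    intro j
    rw [hr]
    dsimp only
    field_simp [(hGpos (j + 1)).ne']
  have hbdd : BddAbove (Set.range r) := ⟨1, by rintro _ ⟨k, rfl⟩; exact hle k⟩
  have hconv : Tendsto r atTop (𝓝 (⨆ k, r k)) := tendsto_atTop_ciSup hmono hbdd
  set L : ℝ := ⨆ k, r k with hL
  have hL1 : L ≤ 1 := ciSup_le hle
  have hrL : ∀ k, r k ≤ L := fun k => le_ciSup hbdd k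
  have hr0 : 0 < r 0 := div_pos (hGpos _) (hGpos _)
  have hL0 : 0 < L := lt_of_lt_of_le hr0 (hrL 0)
  rcases hL1.lt_or_eq with hlt | heq
  · -- `L < 1`: exponential decay against Simon–Lieb
    exfalso
    have hdec : ∀ k : ℕ, G (k + 1) ≤ G 1 * L ^ k := by
      intro k
      induction k with
      | zero => simp
      | succ k ih =>
        rw [show k + 1 + 1 = k + 2 by omega, hstep k, pow_succ]
        calc r k * G (k + 1) ≤ L * (G 1 * L ^ k) := mul_le_mul (hrL k) ih (hGpos _).le hL0.le
          _ = G 1 * (L ^ k * L) := by ring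
    obtain ⟨c, C, hc, hb⟩ := criticalTwoPoint_bounds_holds (d := 3) le_rfl
    have hlow : ∀ k : ℕ, c * (((k : ℝ) + 1) ^ 2)⁻¹ ≤ G (k + 1) := by
      intro k
      have hx : (Pi.single i ((k + 1 : ℕ) : ℤ) : Site 3) ≠ 0 := by
        intro h0
        have := congr_fun h0 i
        simp at this
        omega
      have h1 := (hb _ hx).1
      have hnorm : ‖(Pi.single i ((k + 1 : ℕ) : ℤ) : Site 3)‖ = (k : ℝ) + 1 := by
        rw [Pi.norm_single, Int.norm_eq_abs]
        push_cast
        rw [abs_of_nonneg (by positivity)]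
      rw [hnorm, show (-(((3:ℕ) : ℝ) - 1)) = (-2 : ℝ) by norm_num,
        Real.rpow_neg (by positivity), Real.rpow_two] at h1
      exact h1
    -- `c (k+1)^{-2} ≤ G 1 L^k`, i.e. `c ≤ G 1 (k+1)² L^k → 0`
    have hfin : ∀ k : ℕ, c ≤ G 1 * (((k : ℝ) + 1) ^ 2 * L ^ k) := by
      intro k
      have h := (hlow k).trans (hdec k)
      have hk : (0 : ℝ) < ((k : ℝ) + 1) ^ 2 := by positivity
      have := mul_le_mul_of_nonneg_right h hk.le
      rw [mul_assoc, inv_mul_cancel₀ hk.ne', mul_one] at this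
      linarith [this]
    have hLne : L ≠ 0 := hL0.ne'
    have hbase := tendsto_pow_const_mul_const_pow_of_abs_lt_one 2
      (show |L| < 1 by rwa [abs_of_pos hL0])
    have h1 := hbase.comp (tendsto_add_atTop_nat 1)
    have h2 := h1.const_mul (G 1 * L⁻¹)
    rw [mul_zero] at h2
    have hzero : Tendsto (fun k : ℕ => G 1 * (((k : ℝ) + 1) ^ 2 * L ^ k)) atTop (𝓝 0) := by
      have h3 : (fun k : ℕ => G 1 * (((k : ℝ) + 1) ^ 2 * L ^ k)) =
          fun k => G 1 * L⁻¹ * ((((k + 1 : ℕ) : ℝ)) ^ 2 * L ^ (k + 1)) := by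
        funext k
        push_cast
        field_simp
        ring
      rw [h3]
      exact h2
    have := ge_of_tendsto' hzero hfin
    linarith
  · rw [heq] at hconv
    exact hconv

/-- The same regularity in the unshifted form: `⟨σ₀σ_{(k+1)eᵢ}⟩_{β_c}/⟨σ₀σ_{k eᵢ}⟩_{β_c} → 1`.
[cite: AizenmanDuminilCopinAnnals2021, arXiv:1912.07973 Prop. 5.3 (5.17) and §5.5 proof of Prop. 5.9 (p. 19)] -/
theorem criticalTwoPoint_axis_ratio_tendsto_one' (i : Fin 3) :
    Tendsto (fun k : ℕ => criticalTwoPoint 3 (Pi.single i ((k + 1 : ℕ) : ℤ)) /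
      criticalTwoPoint 3 (Pi.single i (k : ℤ))) atTop (𝓝 1) := by
  have h := criticalTwoPoint_axis_ratio_tendsto_one i
  rw [← tendsto_add_atTop_iff_nat 1]
  exact h.congr fun k => rfl

end Literature.Probability.LatticeModels

end
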